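import Summits.QuantumFields.YangMills.Theorems.LuscherReductionDressedRitzPolyakovLiftGlue
import Summits.QuantumFields.YangMills.Theorems.DressedRitz.Negative.LeakageMixtureHazard
import Summits.QuantumFields.YangMills.Theorems.TwistedTraceScaling.Negative.FixedLatticeTraceLawFalseWithoutThreshold
import HarnessLib

/-!
# Crux `DressedRitz` (stmt-QuantumFields-20205), line «polyakovlift» r2 (`62fcf7b4f9c136d2`) — NEGATIVE lemmas:
# the raw-vacuum NORMALISATION is load-bearing for S-STAT and is the ONLY guard against the degenerate vacuum;
# S-POS-core and S-LEAK are blind to it; exact eigenfamilies are a non-junk model of S-LEAK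

Standing crux disprover `ym-cdisprove-20205-1` g1 (refuter), supporting item stmt-QuantumFields-20205 (no verdict change: the crux and the
three r2 stubs `stub_liftStatics` ∕ `stub_liftPosition` ∕ `stub_liftLeakage` stay OPEN).  Load-bearing analysis of the hypothesis
`IsRawVacuum β φ = IsPhys φ ∧ ⟨φ,φ⟩ = 1 ∧ K_βφ = λ₀φ` shared by the three stubs:

* §1 junk algebra: `K_β 0 = 0`, `⟨0, ψ⟩ = 0` (cf. `KTRCalibration.l2_zero_right`), `ins 0 O = 0`, so the lifted family over the ZERO vacuum is the zero family
  (`liftFamily_zeroVac`);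
* §2 ★ `dynamicClauses_zeroFamily`, `dynamicCoreClauses_zeroFamily`, `leakageClause_zeroFamily` — the time-1 clauses (o1),(o5),(o6),(o7) and the
  time-2 clause (o4) hold for the zero family with EVERY constant `C` (all are homogeneous, division-free inequalities `0 ≤ 0`); hence the S-POS-core and
  S-LEAK clause predicates do not detect a degenerate vacuum at all (`dynamicCoreClauses_liftFamily_zeroVac`, `leakageClause_liftFamily_zeroVac`):
  their whole non-degeneracy rides on clause (o0) of S-STAT;
* §3 ★ `not_staticClauses_liftFamily_zeroVac` and `liftStatics_false_without_normalisation` — S-STAT with the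
  normalisation `⟨φ,φ⟩ = 1` deleted from `IsRawVacuum` (keeping `IsPhys φ` and the eigen-equation) is FALSE: `φ = 0` is then an admissible vacuum
  (the femto window is inhabited, `TwistedTraceScaling.Negative.exists_inFemtoWindow`; a lift basis exists, `PolyakovLift.exists_liftBasis`) and
  (o0) `0 < ⟨u_0,u_0⟩` fails.  So any proof of S-STAT must use `⟨φ,φ⟩ = 1` (indeed `φ ≠ 0`), while S-POS-core ∕ S-LEAK cannot be refuted through
  the vacuum slot;
* §4 `leakageClause_of_eigenfamily` — a NON-JUNK MODEL of the S-LEAK clause: any family of exact physical eigenvectors of `K_β` satisfies (o4) with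
  `C = 0` (defect `κ²n·n − (κn)² = 0`); with `LeakageMixtureHazard.not_leakageClause_of_mixture` (gen 0) this brackets (o4) as «distance from an
  eigenvector».

HONEST FRAMING: hypothesis bookkeeping at fixed lattice on the CONDITIONAL femto rung R2b1; nothing here is an estimate, nothing bears on infinite
volume, the continuum limit or the Clay mass gap.  [folklore]
-/

set_option autoImplicit false

noncomputable section

open MeasureTheory Filter Topology Real
open Literature.MathematicalPhysics.QuantumFieldTheory
open Literature.MathematicalPhysics.QuantumLattice

namespace Summit.QuantumFields.YangMills.Theorems.FemtoTransferGap.PolyakovLift.Negative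

open Summit.QuantumFields.YangMills.Theorems.FemtoTransferGap
open Summit.QuantumFields.YangMills.Theorems.FemtoTransferGap.PolyakovLift

/-! ## §1 Junk algebra at the zero vacuum -/

section Zero

variable {L : ℕ} [NeZero L]

/-- `K_β 0 = 0`. [folklore] -/
theorem transferApply_zeroVec (β : ℝ) :
    transferApply (L := L) β (fun _ => (0 : ℝ)) = fun _ => 0 := by
  funext U
  simp [transferApply]

/-- `⟨0, ψ⟩ = 0`. [folklore] -/
theorem l2_zeroVec_left (ψ : GaugeConfig 3 L SU2 → ℝ) : l2 (fun _ => (0 : ℝ)) ψ = 0 := by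
  unfold l2
  simp

/-- `ins 0 O = 0`: an insertion applied to the zero «vacuum» is the zero vector. [folklore] -/
theorem ins_zeroVac (O : GaugeConfig 3 L SU2 → ℝ) :
    OpPlat.ins (fun _ => (0 : ℝ)) O = fun _ => 0 := by
  funext U
  simp [OpPlat.ins]

/-- The lifted family over the zero vacuum is the zero family, for every basis and flow time. [folklore] -/
theorem liftFamily_zeroVac (β : ℝ) {k : ℕ} (g : Fin k → (GaugeConfig 3 1 SU2 → ℝ)) :
    liftFamily β (fun _ : GaugeConfig 3 L SU2 => (0 : ℝ)) g = fun _ _ => 0 := by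
  funext i
  exact ins_zeroVac _

/-- `0` satisfies the vacuum eigen-equation `K_β 0 = λ₀ • 0`. [folklore] -/
theorem zeroVec_eigen (β : ℝ) :
    transferApply (L := L) β (fun _ => (0 : ℝ)) = levelValue su2Rep L β 0 • (fun _ => (0 : ℝ)) := by
  rw [transferApply_zeroVec]
  funext U
  simp

end Zero

/-! ## §2 The time-1 and time-2 clauses are blind to the degenerate vacuum -/

section Blind

variable {L : ℕ} [NeZero L]

/-- ★ All four time-1 clauses (o1),(o5),(o6),(o7) hold for the ZERO family with every constant `C`. [folklore] -/
theorem dynamicClauses_zeroFamily (k : ℕ) (C β : ℝ) :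
    DynamicClauses k C β (fun (_ : Fin k) (_ : GaugeConfig 3 L SU2) => (0 : ℝ)) := by
  refine ⟨fun i l _ => ?_, fun i => ⟨?_, ?_⟩, fun i l _ => ?_, fun i => ?_⟩ <;>
    simp [transferApply_zeroVec, l2_zeroVec_left]

/-- ★ The S-POS core (o5) ∧ (o6) holds for the zero family with every constant `C`. [folklore] -/
theorem dynamicCoreClauses_zeroFamily (k : ℕ) (C β : ℝ) :
    DynamicCoreClauses k C β (fun (_ : Fin k) (_ : GaugeConfig 3 L SU2) => (0 : ℝ)) :=
  dynamicCoreClauses_of_dynamicClauses (dynamicClauses_zeroFamily k C β)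

/-- ★ The S-LEAK clause (o4) holds for the zero family with every constant `C`. [folklore] -/
theorem leakageClause_zeroFamily (k : ℕ) (C β : ℝ) :
    LeakageClause k C β (fun (_ : Fin k) (_ : GaugeConfig 3 L SU2) => (0 : ℝ)) := by
  intro i
  simp [transferApply_zeroVec, l2_zeroVec_left]

/-- The (o2) half of S-STAT also holds for the zero family with every `C`. [folklore] -/
theorem o2_zeroFamily (k : ℕ) (C β : ℝ) (i l : Fin k) :
    |l2 ((fun (_ : Fin k) (_ : GaugeConfig 3 L SU2) => (0 : ℝ)) i) ((fun (_ : Fin k) (_ : GaugeConfig 3 L SU2) => (0 : ℝ)) l)| ≤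
      C * luscherLambda β L *
        (Real.sqrt (l2 ((fun (_ : Fin k) (_ : GaugeConfig 3 L SU2) => (0 : ℝ)) i) ((fun (_ : Fin k) (_ : GaugeConfig 3 L SU2) => (0 : ℝ)) i)) *
          Real.sqrt (l2 ((fun (_ : Fin k) (_ : GaugeConfig 3 L SU2) => (0 : ℝ)) l) ((fun (_ : Fin k) (_ : GaugeConfig 3 L SU2) => (0 : ℝ)) l))) := by
  simp [l2_zeroVec_left]

/-- Hence S-POS-core holds for the lift of ANY basis over the zero vacuum, at every `β`, `k`, `C`. [folklore] -/
theorem dynamicCoreClauses_liftFamily_zeroVac (k : ℕ) (C β : ℝ) (g : Fin k → (GaugeConfig 3 1 SU2 → ℝ)) :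
    DynamicCoreClauses k C β (liftFamily β (fun _ : GaugeConfig 3 L SU2 => (0 : ℝ)) g) := by
  rw [liftFamily_zeroVac]
  exact dynamicCoreClauses_zeroFamily k C β

/-- … and so does S-LEAK. [folklore] -/
theorem leakageClause_liftFamily_zeroVac (k : ℕ) (C β : ℝ) (g : Fin k → (GaugeConfig 3 1 SU2 → ℝ)) :
    LeakageClause k C β (liftFamily β (fun _ : GaugeConfig 3 L SU2 => (0 : ℝ)) g) := by
  rw [liftFamily_zeroVac]
  exact leakageClause_zeroFamily k C β

end Blind

/-! ## §3 S-STAT detects it: the normalisation `⟨φ,φ⟩ = 1` is load-bearing -/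

section LoadBearing

variable {L : ℕ} [NeZero L]

/-- ★ (o0) fails for the lift of any basis with `k ≥ 1` members over the zero vacuum. [folklore] -/
theorem not_staticClauses_liftFamily_zeroVac {k : ℕ} (hk : 0 < k) (C β : ℝ) (g : Fin k → (GaugeConfig 3 1 SU2 → ℝ)) :
    ¬ StaticClauses k C β (liftFamily β (fun _ : GaugeConfig 3 L SU2 => (0 : ℝ)) g) := by
  rw [liftFamily_zeroVac]
  rintro ⟨h0, -⟩
  have h := h0 ⟨0, hk⟩
  simp [l2_zeroVec_left] at h

end LoadBearing

/-- ★★ **S-STAT WITHOUT THE NORMALISATION is false — any proof of S-STAT must use `⟨φ,φ⟩ = 1`.**  The negated statement is the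
registered stub `stub_liftStatics` of «polyakovlift» r2 VERBATIM except that `IsRawVacuum β φ` is weakened to `IsPhys φ ∧ K_βφ = λ₀φ` (the
clause `⟨φ,φ⟩ = 1` deleted).  Witness: `k = 1`, depth `lam = min lam0 1`, lattice `L = L0 + 1`, a `β` in the window (the window is
inhabited), the zero vacuum and any lift basis at `B₁ = 2/λ³ > 0` (one exists); clause (o0) then reads `0 < 0`. [folklore] -/
theorem liftStatics_false_without_normalisation :
    ¬ (∀ k : ℕ, ∃ C lam0 : ℝ, 0 ≤ C ∧ 0 < lam0 ∧ ∀ lam : ℝ, 0 < lam → lam ≤ lam0 → ∃ L0 : ℕ,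
        ∀ (L : ℕ) [NeZero L], L0 ≤ L → ∀ β : ℝ, InFemtoWindow lam β L →
          ∀ φ : GaugeConfig 3 L SU2 → ℝ, IsPhys φ → transferApply β φ = levelValue su2Rep L β 0 • φ →
            ∀ (ω : GaugeConfig 3 1 SU2 → ℝ) (g : Fin k → (GaugeConfig 3 1 SU2 → ℝ)), LiftBasis (liftCoupling β L) k ω g →
              StaticClauses k C β (liftFamily β φ g)) := by
  intro h
  obtain ⟨C, lam0, -, hlam0, H⟩ := h 1
  have hlam : 0 < min lam0 1 := lt_min hlam0 one_pos
  obtain ⟨L0, HL⟩ := H (min lam0 1) hlam (min_le_left _ _)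
  obtain ⟨β, hW, hval⟩ :=
    Summit.QuantumFields.YangMills.Theorems.TwistedTraceScaling.Negative.exists_inFemtoWindow (L0 + 1) hlam (min_le_right _ _)
  have hB : 0 < liftCoupling β (L0 + 1) := by
    unfold liftCoupling
    rw [hval]
    positivity
  obtain ⟨ω, g, hbasis⟩ := exists_liftBasis hB 1
  have hS := HL (L0 + 1) (Nat.le_succ _) β hW (fun _ => (0 : ℝ)) (isPhys_const 0) (zeroVec_eigen β) ω g hbasis
  exact not_staticClauses_liftFamily_zeroVac one_pos C β g hS

/-- The registered S-STAT body implies the mutated one restricted to normalised vacua — i.e. the mutation deletes exactly one clause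
(sanity: `IsRawVacuum β φ ↔ IsPhys φ ∧ ⟨φ,φ⟩ = 1 ∧ K_βφ = λ₀φ`). [folklore] -/
theorem isRawVacuum_iff {L : ℕ} [NeZero L] (β : ℝ) (φ : GaugeConfig 3 L SU2 → ℝ) :
    IsRawVacuum β φ ↔ IsPhys φ ∧ l2 φ φ = 1 ∧ transferApply β φ = levelValue su2Rep L β 0 • φ :=
  Iff.rfl

/-! ## §4 A non-junk model of the S-LEAK clause: exact eigenfamilies -/

section Eigen

variable {L : ℕ} [NeZero L]

/-- ★ Exact physical eigenvectors of `K_β` satisfy the leakage clause (o4) with constant `0`: `‖K u‖²·n − ⟨u,Ku⟩² = κ²n·n − (κn)² = 0`.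
Together with `not_leakageClause_of_mixture` (gen 0) this exhibits (o4) as a measure of the distance of `u_i` from an eigenvector. [folklore] -/
theorem leakageClause_of_eigenfamily (β : ℝ) {k : ℕ} {u : Fin k → (GaugeConfig 3 L SU2 → ℝ)} {κ : Fin k → ℝ}
    (heig : ∀ i, transferApply β (u i) = κ i • u i) : LeakageClause k 0 β u := by
  intro i
  rw [heig i, l2_smul_left, l2_smul_right'']
  have : (κ i * (κ i * l2 (u i) (u i))) * l2 (u i) (u i) - (κ i * l2 (u i) (u i)) ^ 2 = 0 := by ring
  rw [this]
  simp

end Eigen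

end Summit.QuantumFields.YangMills.Theorems.FemtoTransferGap.PolyakovLift.Negative

end
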